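import Summits.QuantumFields.GaugeBoot.FrameLowerSlab
import Summits.QuantumFields.GaugeBoot.TiltedLinkRPPositivity
import Summits.QuantumFields.GaugeBoot.SlabKernelAnnulus
import Summits.QuantumFields.GaugeBoot.TiltedFrameNoGo
import HarnessLib

/-!
# Two-dimensional site frames: the two annuli of the link mirror (gauge-boot, L3 positive supplement; link reflection in two dimensions at every `β`, part 1)

HONEST FRAMING (cell `pub-gaugeboot`, page 1 of every file): the venture produces certified bounds
on lattice expectations at stated coupling, gauge group, dimension and torus size; NOT a mass gap,
NOT a continuum limit, NOT a string tension; NOT Yang–Mills-summit-bearing (barriers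
`FixedCouplingUltralocality`, `PerturbativeInvisibility`). Geometric bookkeeping for a POSITIVE
structural result (`FrameTwoDimLinkRP.lean`); it bounds no expectation of the venture's tables.

Setting. A periodic lattice `(A, e)` with a SITE FRAME `IsSiteFrame e k σ Q h` along `k`
(`TiltedSiteRPGeometry.lean`) and its mid-plane (link) reflection `Θ`, `x ↦ σ x + e_k`
(`TiltedLinkRPGeometry.lean`). `FrameLinkRPNegativeBeta.lean` proved that with THREE directions
(`d ≥ 3`) link reflection positivity FAILS at every `β < 0` for `SU(3)`-type representations. This
file opens the complementary TWO-DIMENSIONAL case: **`IsTwoDimFrame e k l σ Q h m`** — a site frame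
along `k`, exactly one further direction `l` (`∀ n, n = k ∨ n = l`), the site group generated by
`e_k, e_l`, and the transverse translation `e_l` of EVEN order `2m` (e.g. every axis of the cubic torus
`(ℤ/2Q)^2`, `m = Q`). Then every layer `h = c` is ONE cycle `c•e_k + t•e_l`, `t < 2m`
(`exists_eq_site`), every plaquette lies in the `(k, l)` plane (`snd_eq`, `hasDir`), and the crossing
plaquettes of the Osterwalder–Seiler splitting form TWO closed annuli of `2m` plaquettes each — the
lower one between the layers `0|1`, the upper one between `Q|Q+1` — in exactly the shape
`∏_{t<2m} plaqWt ω r a b t` of the Migdal recursion `SlabKernel.integral_mul_annulus`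
(`prod_exp_lower_eq_prod_plaqWt`, `prod_exp_upper_eq_prod_plaqWt`; rungs `rung₂ c t = (c e_k + t e_l, k)`,
letters `lo₂ c t = U(c e_k + t e_l, l)`, `up₂ c t = U((c+1) e_k + t e_l, l)`). Under `Θ` the letter words
are exchanged EXACTLY (`up_zero_configMidReflect`, `lo_self_configMidReflect`: no twist, both layers
`0` and `Q` being pointwise fixed by `σ`), the rungs are crossing links, and positive links are blind
to the rungs (`apply_update_rung`, `configMidReflect_update_rung`). Everything is `[folklore]`
bookkeeping (Migdal 1975; Osterwalder–Seiler 1978 §2).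

References: A. A. Migdal, Sov. Phys. JETP 42 (1975) 413; K. Osterwalder, E. Seiler, Ann. Phys. 110
(1978) 440, §2; J. Fröhlich, R. Israel, E. H. Lieb, B. Simon, J. Stat. Phys. 22 (1980) 297, §3.
-/

noncomputable section

open Function
open Literature.RepresentationTheory.CompactGroups

namespace Summit.QuantumFields.GaugeBoot

namespace TiltedRP

variable {A : Type*} [AddCommGroup A] {d : ℕ}

/-! ## Two-dimensional site frames -/

/-- **A two-dimensional site frame**: a site frame `(σ, Q, h)` along `k` on the periodic lattice
`(A, e)` together with ONE further direction `l ≠ k` exhausting the directions (`∀ n, n = k ∨ n = l`),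
the site group generated by `e_k, e_l`, and the transverse translation `e_l` of even order `2m`,
`m ≥ 1`. [folklore] -/
structure IsTwoDimFrame (e : Fin d → A) (k l : Fin d) (σ : A →+ A) (Q : ℕ) (h : A →+ ZMod (2 * Q))
    (m : ℕ) : Prop extends IsSiteFrame e k σ Q h where
  /-- The transverse direction is not the frame direction. -/
  ne : l ≠ k
  /-- There are exactly the two directions `k`, `l`. -/
  dirs : ∀ n : Fin d, n = k ∨ n = l
  /-- The site group is generated by `e_k` and `e_l`. -/
  gen : ∀ y : A, ∃ c t : ℕ, y = c • e k + t • e l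
  /-- The half length of the transverse cycle is at least `1`. -/
  one_le : 1 ≤ m
  /-- The transverse translation has even order `2m`. -/
  addOrderOf_eq : addOrderOf (e l) = 2 * m

/-! ## Sites, rungs and letters of the annuli -/

namespace TwoDimFrame

section Defs

variable (e : Fin d → A) (k l : Fin d)

/-- The site `(c, t) = c • e_k + t • e_l` (height `c`, transverse position `t`). -/
def site₂ (c t : ℕ) : A := c • e k + t • e l

/-- The `t`-th rung of the annulus above the layer `c`: the `k`-link from `(c, t)` to `(c+1, t)`. -/
def rung₂ (c t : ℕ) : Link A d := (site₂ e k l c t, k)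

variable {G : Type*}

/-- The `t`-th lower letter of the annulus above the layer `c`: the `l`-link variable at `(c, t)`. -/
def lo₂ (c t : ℕ) (U : Config A d G) : G := U (site₂ e k l c t, l)

/-- The `t`-th upper letter of the annulus above the layer `c`: the `l`-link variable at `(c+1, t)`. -/
def up₂ (c t : ℕ) (U : Config A d G) : G := U (site₂ e k l (c + 1) t, l)

end Defs

end TwoDimFrame

namespace IsTwoDimFrame

open TwoDimFrame

variable {e : Fin d → A} {k l : Fin d} {σ : A →+ A} {Q : ℕ} {h : A →+ ZMod (2 * Q)} {m : ℕ}
variable (hT : IsTwoDimFrame e k l σ Q h m)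
include hT

/-! ## Sites: heights, steps, the period, injectivity, the layers are cycles -/

omit hT in
/-- One step up: `(c, t) + e_k = (c+1, t)`. [folklore] -/
theorem site_add_e_self (c t : ℕ) : site₂ e k l c t + e k = site₂ e k l (c + 1) t := by
  simp only [site₂, succ_nsmul]
  abel

omit hT in
/-- One step along: `(c, t) + e_l = (c, t+1)`. [folklore] -/
theorem site_add_e_other (c t : ℕ) : site₂ e k l c t + e l = site₂ e k l c (t + 1) := by
  simp only [site₂, succ_nsmul]
  abel

/-- The height of `(c, t)` is `c`. [folklore] -/
theorem height_site (c t : ℕ) : h (site₂ e k l c t) = (c : ZMod (2 * Q)) := by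
  simp only [site₂, map_add, map_nsmul, hT.height_self, hT.height_other l hT.ne, smul_zero, add_zero,
    nsmul_one]

/-- The height of `(c, t)` read in `[0, 2Q)`: `c` for `c < 2Q`. [folklore] -/
theorem val_height_site {c : ℕ} (hc : c < 2 * Q) (t : ℕ) : (h (site₂ e k l c t)).val = c := by
  rw [hT.height_site, ZMod.val_natCast, Nat.mod_eq_of_lt hc]

/-- `2m • e_l = 0`. [folklore] -/
theorem two_mul_nsmul_e_other : (2 * m) • e l = 0 := by
  rw [← hT.addOrderOf_eq]
  exact addOrderOf_nsmul_eq_zero (e l)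

/-- The transverse period: `(c, t + 2m) = (c, t)`. [folklore] -/
theorem site_add_period (c t : ℕ) : site₂ e k l c (t + 2 * m) = site₂ e k l c t := by
  simp only [site₂, add_nsmul, hT.two_mul_nsmul_e_other, add_zero]

/-- The annulus closes: `rung₂ c (2m) = rung₂ c 0`. [folklore] -/
theorem rung_period (c : ℕ) : rung₂ e k l c (2 * m) = rung₂ e k l c 0 := by
  have h0 := hT.site_add_period c 0
  rw [zero_add] at h0
  simp only [rung₂, h0]

/-- `t • e_l` only depends on `t mod 2m`. [folklore] -/
theorem nsmul_e_other_mod (t : ℕ) : (t % (2 * m)) • e l = t • e l := by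
  rw [← hT.addOrderOf_eq, mod_addOrderOf_nsmul]

/-- `c • e_k` only depends on `c mod 2Q`. [folklore] -/
theorem nsmul_e_self_mod (c : ℕ) : (c % (2 * Q)) • e k = c • e k := by
  rw [← hT.addOrderOf_e_self, mod_addOrderOf_nsmul]

/-- Injectivity of the transverse position on one period. [folklore] -/
theorem site_injOn {c s t : ℕ} (hs : s < 2 * m) (ht : t < 2 * m)
    (hst : site₂ e k l c s = site₂ e k l c t) : s = t := by
  have h1 : s • e l = t • e l := add_left_cancel hst
  have hfin : IsOfFinAddOrder (e l) := addOrderOf_pos_iff.1 (by rw [hT.addOrderOf_eq]; have := hT.one_le; omega)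
  have h2 := (hfin.nsmul_inj_mod).1 h1
  rwa [hT.addOrderOf_eq, Nat.mod_eq_of_lt hs, Nat.mod_eq_of_lt ht] at h2

/-- The rungs of one annulus are distinct. [folklore] -/
theorem rung_inj (c : ℕ) : ∀ s t, s < 2 * m → t < 2 * m → rung₂ e k l c s = rung₂ e k l c t → s = t :=
  fun _ _ hs ht hst => hT.site_injOn hs ht (congrArg Prod.fst hst)

/-- **Every layer is one transverse cycle**: `y = (h y) • e_k + t • e_l` with `t < 2m`. [folklore] -/
theorem exists_eq_site (y : A) : ∃ t, t < 2 * m ∧ y = site₂ e k l (h y).val t := by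
  obtain ⟨c, t, rfl⟩ := hT.gen y
  have hm := hT.one_le
  refine ⟨t % (2 * m), Nat.mod_lt _ (by omega), ?_⟩
  have hh : h (c • e k + t • e l) = (c : ZMod (2 * Q)) := hT.height_site c t
  rw [hh, ZMod.val_natCast]
  simp only [site₂, hT.nsmul_e_other_mod, hT.nsmul_e_self_mod]

/-! ## Plaquettes: all in the `(k, l)` plane -/

/-- Every direction pair is `{k, l}`. [folklore] -/
theorem snd_eq (p : Plaq A d) : p.2 = mkDirPair k l hT.ne := by
  obtain ⟨x, ⟨⟨a, b⟩, hab⟩⟩ := p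
  rcases hT.dirs a with ha | ha <;> rcases hT.dirs b with hb | hb <;> subst ha <;> subst hb
  · exact absurd hab (lt_irrefl _)
  · simp only [mkDirPair, dif_pos hab]
  · simp only [mkDirPair, dif_neg (not_lt.2 hab.le)]
  · exact absurd hab (lt_irrefl _)

/-- Every plaquette has a `k`-side. [folklore] -/
theorem hasDir (p : Plaq A d) : HasDir p k := by
  unfold HasDir
  rw [hT.snd_eq p]
  exact mkDirPair_hasDir k l hT.ne

/-- The other direction of every plaquette is `l`. [folklore] -/
theorem otherDir_eq (p : Plaq A d) : otherDir k p = l := by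
  have h1 := otherDir_mkDirPair p.1 k l hT.ne
  rwa [← hT.snd_eq p] at h1

/-! ## The plaquette weights of the annuli -/

section Weights

variable {N : ℕ} {G : Type*} [Group G] [TopologicalSpace G] [IsTopologicalGroup G] [CompactSpace G]
variable (ρ : G →* Matrix (Fin N) (Fin N) ℂ)

/-- **One plaquette of an annulus**: the Boltzmann factor of the plaquette based at `(c, t)` is the
`t`-th plaquette weight of the annulus above the layer `c`,
`exp(β Re tr ρ(U_p)) = ω_β(lo_t · U(rung_{t+1}) · up_t⁻¹ · U(rung_t)⁻¹)`. [folklore] -/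
theorem exp_plaqObs_eq_plaqWt (hρ : Continuous ρ) (β : ℝ) (U : Config A d G) {p : Plaq A d}
    {c t : ℕ} (hp : p.1 = site₂ e k l c t) :
    ((Real.exp (β * plaqObs ρ e p U) : ℝ) : ℂ) =
      SlabKernel.plaqWt (SlabKernel.wilsonWt ρ β) (rung₂ e k l c) (lo₂ e k l c) (up₂ e k l c) t U := by
  have hX : holonomy e U p.1 k l =
      (lo₂ e k l c t U * U (rung₂ e k l c (t + 1)) * (up₂ e k l c t U)⁻¹ * (U (rung₂ e k l c t))⁻¹)⁻¹ := by
    simp only [holonomy, lo₂, up₂, rung₂, hp, site_add_e_self, site_add_e_other, mul_inv_rev, inv_inv,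
      mul_assoc]
  rw [IsSiteFrame.plaqObs_of_hasDir ρ hρ (hT.hasDir p), hT.otherDir_eq, hX, CompactGroup.re_trace_map_inv ρ hρ]
  rfl

open scoped Classical in
/-- The lower slab plaquettes are the plaquettes based at `(0, t)`, `t < 2m`. [folklore] -/
theorem filter_isLowerPlaq_eq [Fintype A] :
    Finset.univ.filter (IsLowerPlaq k Q h) =
      (Finset.range (2 * m)).image fun t => ((site₂ e k l 0 t, mkDirPair k l hT.ne) : Plaq A d) := by
  have hQ := hT.two_le
  ext p
  simp only [Finset.mem_filter, Finset.mem_univ, true_and, Finset.mem_image, Finset.mem_range]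
  constructor
  · rintro ⟨-, h0⟩
    obtain ⟨t, ht, hy⟩ := hT.exists_eq_site p.1
    rw [h0] at hy
    exact ⟨t, ht, Prod.ext hy.symm (hT.snd_eq p).symm⟩
  · rintro ⟨t, -, rfl⟩
    exact ⟨hT.hasDir _, hT.val_height_site (by omega) t⟩

open scoped Classical in
/-- The upper slab plaquettes are the plaquettes based at `(Q, t)`, `t < 2m`. [folklore] -/
theorem filter_isUpperPlaq_eq [Fintype A] :
    Finset.univ.filter (IsUpperPlaq k Q h) =
      (Finset.range (2 * m)).image fun t => ((site₂ e k l Q t, mkDirPair k l hT.ne) : Plaq A d) := by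
  have hQ := hT.two_le
  ext p
  simp only [Finset.mem_filter, Finset.mem_univ, true_and, Finset.mem_image, Finset.mem_range]
  constructor
  · rintro ⟨-, h0⟩
    obtain ⟨t, ht, hy⟩ := hT.exists_eq_site p.1
    rw [h0] at hy
    exact ⟨t, ht, Prod.ext hy.symm (hT.snd_eq p).symm⟩
  · rintro ⟨t, -, rfl⟩
    exact ⟨hT.hasDir _, hT.val_height_site (by omega) t⟩

open scoped Classical in
/-- **The lower annulus**: `∏_{p lower} exp(β Re tr ρ(U_p)) = ∏_{t<2m} plaqWt_t` (rungs and letters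
above the layer `0`). [folklore] -/
theorem prod_exp_lower_eq_prod_plaqWt [Fintype A] (hρ : Continuous ρ) (β : ℝ) (U : Config A d G) :
    ∏ p ∈ Finset.univ.filter (IsLowerPlaq k Q h), ((Real.exp (β * plaqObs ρ e p U) : ℝ) : ℂ) =
      ∏ t ∈ Finset.range (2 * m),
        SlabKernel.plaqWt (SlabKernel.wilsonWt ρ β) (rung₂ e k l 0) (lo₂ e k l 0) (up₂ e k l 0) t U := by
  rw [hT.filter_isLowerPlaq_eq, Finset.prod_image]
  · exact Finset.prod_congr rfl fun t _ => hT.exp_plaqObs_eq_plaqWt ρ hρ β U rfl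
  · intro s hs t ht hst
    exact hT.site_injOn (Finset.mem_range.1 hs) (Finset.mem_range.1 ht) (congrArg Prod.fst hst)

open scoped Classical in
/-- **The upper annulus**: `∏_{p upper} exp(β Re tr ρ(U_p)) = ∏_{t<2m} plaqWt_t` (rungs and letters
above the layer `Q`). [folklore] -/
theorem prod_exp_upper_eq_prod_plaqWt [Fintype A] (hρ : Continuous ρ) (β : ℝ) (U : Config A d G) :
    ∏ p ∈ Finset.univ.filter (IsUpperPlaq k Q h), ((Real.exp (β * plaqObs ρ e p U) : ℝ) : ℂ) =
      ∏ t ∈ Finset.range (2 * m),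
        SlabKernel.plaqWt (SlabKernel.wilsonWt ρ β) (rung₂ e k l Q) (lo₂ e k l Q) (up₂ e k l Q) t U := by
  rw [hT.filter_isUpperPlaq_eq, Finset.prod_image]
  · exact Finset.prod_congr rfl fun t _ => hT.exp_plaqObs_eq_plaqWt ρ hρ β U rfl
  · intro s hs t ht hst
    exact hT.site_injOn (Finset.mem_range.1 hs) (Finset.mem_range.1 ht) (congrArg Prod.fst hst)

end Weights

/-! ## The letters under the reflection: both slabs are exact -/

/-- `Θ` lowers the layer `1` onto the layer `0`: `θ (1, t) = (0, t)`. [folklore] -/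
theorem midReflect_site_one (t : ℕ) : midReflect e k σ (site₂ e k l 1 t) = site₂ e k l 0 t := by
  have hQ := hT.two_le
  rw [← site_add_e_self, hT.midReflect_add_self,
    hT.map_of_val (Or.inl (hT.val_height_site (by omega) t))]

/-- `Θ` raises the layer `Q` onto the layer `Q + 1`: `θ (Q, t) = (Q+1, t)`. [folklore] -/
theorem midReflect_site_self (t : ℕ) : midReflect e k σ (site₂ e k l Q t) = site₂ e k l (Q + 1) t := by
  have hQ := hT.two_le
  rw [hT.midReflect_of_isLayer (hT.isLayer_of_val (Or.inr (hT.val_height_site (by omega) t))),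
    site_add_e_self]

variable {G : Type*} [Group G]

/-- The upper letters of the lower annulus, reflected, are its lower letters:
`up₂ 0 t (ΘU) = lo₂ 0 t U`. [folklore] -/
theorem up_zero_configMidReflect (t : ℕ) (U : Config A d G) :
    up₂ e k l 0 t (configMidReflect e k σ U) = lo₂ e k l 0 t U := by
  simp only [up₂, lo₂, configMidReflect_other e k σ U _ hT.ne, zero_add, hT.midReflect_site_one]

/-- The lower letters of the upper annulus, reflected, are its upper letters:
`lo₂ Q t (ΘU) = up₂ Q t U`. [folklore] -/
theorem lo_self_configMidReflect (t : ℕ) (U : Config A d G) :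
    lo₂ e k l Q t (configMidReflect e k σ U) = up₂ e k l Q t U := by
  simp only [up₂, lo₂, configMidReflect_other e k σ U _ hT.ne, hT.midReflect_site_self]

/-- The word of the layer `1`, reflected, is the word of the layer `0`. [folklore] -/
theorem oprod_up_zero_configMidReflect (n : ℕ) (U : Config A d G) :
    SlabKernel.oprod (up₂ e k l 0) n (configMidReflect e k σ U) = SlabKernel.oprod (lo₂ e k l 0) n U := by
  unfold SlabKernel.oprod
  congr 1
  exact List.map_congr_left fun t _ => hT.up_zero_configMidReflect t U

/-- The word of the layer `Q`, reflected, is the word of the layer `Q + 1`. [folklore] -/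
theorem oprod_lo_self_configMidReflect (n : ℕ) (U : Config A d G) :
    SlabKernel.oprod (lo₂ e k l Q) n (configMidReflect e k σ U) = SlabKernel.oprod (up₂ e k l Q) n U := by
  unfold SlabKernel.oprod
  congr 1
  exact List.map_congr_left fun t _ => hT.lo_self_configMidReflect t U

/-! ## Rungs are crossing links; letters and positive links do not see them -/

/-- The rungs above the layers `0` and `Q` are crossing links. [folklore] -/
theorem isMidCrossLink_rung {c : ℕ} (hc : c = 0 ∨ c = Q) (t : ℕ) :
    IsMidCrossLink k Q h (rung₂ e k l c t) := by
  have hQ := hT.two_le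
  refine ⟨rfl, ?_⟩
  rcases hc with rfl | rfl
  · exact Or.inl (hT.val_height_site (by omega) t)
  · exact Or.inr (hT.val_height_site (by omega) t)

/-- A lower rung is not an upper rung. [folklore] -/
theorem rung_self_ne_rung_zero (s t : ℕ) : rung₂ e k l Q s ≠ rung₂ e k l 0 t := by
  have hQ := hT.two_le
  intro h'
  have h1 := congrArg (fun r : Link A d => (h r.1).val) h'
  simp only [rung₂, hT.val_height_site (show Q < 2 * Q by omega),
    hT.val_height_site (show 0 < 2 * Q by omega)] at h1
  omega

/-- The letter links `(1, t; l)` of the layer `1` are positive links. [folklore] -/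
theorem isMidPosLink_site_one (t : ℕ) : IsMidPosLink e Q h (site₂ e k l 1 t, l) := by
  have hQ := hT.two_le
  exact hT.isMidPosLink_other hT.ne (by rw [hT.val_height_site (by omega)])
    (by rw [hT.val_height_site (by omega)]; omega)

/-- The letter links `(Q, t; l)` of the layer `Q` are positive links. [folklore] -/
theorem isMidPosLink_site_self (t : ℕ) : IsMidPosLink e Q h (site₂ e k l Q t, l) := by
  have hQ := hT.two_le
  exact hT.isMidPosLink_other hT.ne (by rw [hT.val_height_site (by omega)]; omega)
    (by rw [hT.val_height_site (by omega)])

variable [DecidableEq A]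

omit [Group G] in
/-- Lower letters do not see any rung. [folklore] -/
theorem lo_update (c t c' s : ℕ) (U : Config A d G) (z : G) :
    lo₂ e k l c t (update U (rung₂ e k l c' s) z) = lo₂ e k l c t U := by
  simp only [lo₂, rung₂]
  rw [update_of_ne]
  exact fun h' => hT.ne (congrArg Prod.snd h')

omit [Group G] in
/-- Upper letters do not see any rung. [folklore] -/
theorem up_update (c t c' s : ℕ) (U : Config A d G) (z : G) :
    up₂ e k l c t (update U (rung₂ e k l c' s) z) = up₂ e k l c t U := by
  simp only [up₂, rung₂]
  rw [update_of_ne]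
  exact fun h' => hT.ne (congrArg Prod.snd h')

omit [Group G] in
/-- **Positive links do not see the rungs.** [folklore] -/
theorem apply_update_rung {c : ℕ} (hc : c = 0 ∨ c = Q) (s : ℕ) (U : Config A d G) (z : G)
    {l' : Link A d} (hl' : IsMidPosLink e Q h l') : update U (rung₂ e k l c s) z l' = U l' :=
  update_of_ne (fun h' => hT.not_isMidPosLink_of_isMidCrossLink
    (by rw [h']; exact hT.isMidCrossLink_rung hc s) hl') z U

/-- **The reflected configuration, read on positive links, does not see the rungs** (the reflection
carries a positive link to a non-crossing link). [folklore] -/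
theorem configMidReflect_update_rung {c : ℕ} (hc : c = 0 ∨ c = Q) (s : ℕ) (U : Config A d G) (z : G)
    {l' : Link A d} (hl' : IsMidPosLink e Q h l') :
    configMidReflect e k σ (update U (rung₂ e k l c s) z) l' = configMidReflect e k σ U l' := by
  have hne : midLinkMap e k σ l' ≠ rung₂ e k l c s := fun h' =>
    hT.not_isMidCrossLink_midLinkMap hl' (h' ▸ hT.isMidCrossLink_rung hc s)
  simp only [configMidReflect, update_of_ne hne]

end IsTwoDimFrame

end TiltedRP

end Summit.QuantumFields.GaugeBoot

end
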